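import Summits.QuantumFields.YangMills.Theorems.BalabanUVNodesN15UnitLayerBgFamilyLetters

/-!
# Route «BalabanUVNodes», cluster K4 «SpineRates» — node N15 = NE2, UNIT-LATTICE LAYER WITH THE BACKGROUND LIVE, file U-C3 (dag-n15-a g16, LOCATED-1):
# THE MIDDLE FACTOR's THREE ENTRY LETTERS WITH UNIFORM CONSTANTS over dag-n15-c's primitive-carrier family (the `∃`-packaging of file U-C2's per-index theorem)

Cell `pub-ymgap`, seat `pub-ymgap-dag-n15-a` (-a KNIT-BY-NAME seat of node N15; HUMAN RULING D-0062; chair R424 venue), generation 16, file U-C3 of the LOCATED-1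
programme (INBOX l.22312 ∕ l.22757 ∕ l.23054).  `bears_on: R4∕N15 · K3⁷ SpineGivenEndpointR13SepCoPH (stmt-QuantumFields-20544)`.  Filed `--kind proof --supports
stmt-QuantumFields-20544 --as helper` — COUNT-NEUTRAL.  THEOREMS ONLY (one), 0 `sorry`.  Imports BY NAME file U-C2 `…N15UnitLayerBgFamilyLetters` (`hasMaj_zOp_letters_at`,
`abs_unitBondMat_le_of_hasMaj`, `unitBondMat_sub`; through it FILE 8 `uniform_layer_fullG`); nothing in the tree is modified.  (Split off U-C2 for the gate's 400-line rule.)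

WHAT.  ★★★ `zOp_family_letters`: for odd `L ≥ 3`, `b > 0`, `c₃₅ > 0` there are `δ_Z, ζ, τ, a₁ > 0` (after `d, L, b, c₃₅` only) such that for EVERY index `i = ((m_T, k, m), ν)` of the
torus family of record, EVERY `0 < α₀ ≤ a₁` and EVERY coefficient configuration `U` regular at level `c₃₅` on the PRIMITIVE carrier (`(fgInstanceC2 d hL i).Bf.Reg335 c₃₅ α₀ U`:
the sup letters `|U|, |∇′U|, |∇′∇′U| ≤ c₃₅α₀`), with `Ū = avg₁ kingPrV U`: `|unitBondMat Z^{(k)}(Ū)|, |unitBondMat Z^{(k+m)}(U)| ≤ ζ·α₀·e^{−δ_Zρ}` and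
`|unitBondMat Z^{(k+m)}(U) − unitBondMat Z^{(k)}(Ū)| ≤ τ·(L^k)^{−1∕16}·e^{−δ_Zρ}` — FILE 8's thirteen uniform `U ≡ 1` letters at `γ = 1∕16`, threshold `a₁ = min 1 (1∕(2(Q+1)))`
(`Q` the Neumann guard quantity): SMALLNESS IN `α₀` ALONE, NO weight window.

HONEST FRAMING.  Count-neutral assembly BY NAME; MODEL-LEVEL exactly as the by-parts family is (abelianised first-order species and `Q`, block-averaged coarse partner,
linearised dressing downstream); GENUINE full `U ≡ 1` propagator.  NOT [B9] Thm 3.15 at a general `U`; N15 NOT discharged (typed 28∕28 · discharged 5∕27 of record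
unchanged); nothing continuum ∕ ℝ⁴ ∕ OS ∕ mass-gap ∕ Clay.  Restate-immune (no Theses import).
-/

set_option autoImplicit false

noncomputable section

open scoped BigOperators
open Finset

namespace Summit.QuantumFields.YangMills.BalabanUVNodes.N15.UnitLayerBg

open Literature.MathematicalPhysics.QuantumFieldTheory.Balaban1983to89
open Literature.MathematicalPhysics.QuantumFieldTheory.Balaban1983to89.B11SectG (BlockNorm HasMaj RowSum hasMaj_comp_exp)
open Literature.MathematicalPhysics.QuantumFieldTheory.Balaban1983to89.T4EtaRateDefect (idef)
open Literature.MathematicalPhysics.QuantumFieldTheory.Balaban1983to89.T4EtaRateCoeffDefect (pull blockAvg)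
open Literature.MathematicalPhysics.QuantumFieldTheory.Balaban1983to89.B5Prop11Plancherel (Tor fine)
open Literature.MathematicalPhysics.QuantumFieldTheory.Balaban1983to89.B6UnitTorusCarrier (unitTorusGeo triangle254_unitTorusGeo rowSum_unitTorusGeo unitTorusGeo_dist_nonneg
  unitTorusGeo_dist_self pdist_rep_rep)
open Literature.MathematicalPhysics.QuantumFieldTheory.Balaban1983to89.B4Sect5Proof (latticeConst latticeConst_nonneg)
open Literature.MathematicalPhysics.QuantumFieldTheory.Balaban1983to89.B11AxialTransport190 (abs_le_loc_ofBlocks loc_ofBlocks_le)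
open Literature.MathematicalPhysics.QuantumFieldTheory.Balaban1983to89.B6Lemma24Torus (pbox)
open Literature.MathematicalPhysics.QuantumFieldTheory.Balaban1983to89.B6BondEliminationTorus (pdist)
open Literature.MathematicalPhysics.QuantumFieldTheory.Balaban1983to89.B6Cov2156Torus (one_le_M)
open Literature.MathematicalPhysics.QuantumFieldTheory.Balaban1983to89.B6LowerBound2153Torus (toT rep toT_rep rep_toT rep_mem_pbox)
open Literature.MathematicalPhysics.QuantumFieldTheory.King1986 (exp_decay_mono)
open Literature.MathematicalPhysics.QuantumFieldTheory.King1986.Torus (blockOf tdistT tdistT_nonneg tdistT_self)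
open Summit.QuantumFields.YangMills.BalabanUVNodes.N15.TwoGrid (gOp symbOp sD qvRe qvAdjRe TGIndex)
open Summit.QuantumFields.YangMills.BalabanUVNodes.N15.VectorPiece (blkFine kingPrV blkFine_comp_kingPrV bshiftEquiv)
open Summit.QuantumFields.YangMills.BalabanUVNodes.N15.BackgroundLayer (bgPair projO unstack avg₁ fgD fgInstanceC2 reg_slim_of_C2 uniform_layer_fullG hasMaj_entry01_background₁
  abs_blockAvg_le bgConst bgConst_nonneg inv_pow_le_rate)
open Summit.QuantumFields.YangMills.BalabanUVNodes.N15.BackgroundModel (kappa_ofBlocks)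

variable {d : ℕ}

/-! ## §3 The family: uniform constants over the torus family of record -/

section Family

variable {L : ℕ} [NeZero L]

/-- ★★★ **THE THREE LETTERS OF THE MIDDLE FACTOR, UNIFORM OVER THE PRIMITIVE-CARRIER FAMILY.**  For `d ≥ 0`, odd `L ≥ 3`, `b > 0`, `c₃₅ > 0` there are `δ_Z, ζ, τ, a₁ > 0` (after
`d, L, b, c₃₅`) such that for EVERY index `i = ((m_T, k, m), ν)`, EVERY `0 < α₀ ≤ a₁` and EVERY configuration `U` of dag-n15-c's primitive carrier regular at level `c₃₅`
(`|U|, |∇′U|, |∇′∇′U| ≤ c₃₅α₀`), with `Ū = avg₁ kingPrV U` the block-averaged coarse partner, the bond matrices of the middle factors satisfy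
`|Z^{(k)}(Ū)(b,b′)|, |Z^{(k+m)}(U)(b,b′)| ≤ ζ·α₀·e^{−δ_Zρ_M(b₋,b′₋)}` and `|Z^{(k+m)}(U)(b,b′) − Z^{(k)}(Ū)(b,b′)| ≤ τ·(L^k)^{−1∕16}·e^{−δ_Zρ_M(b₋,b′₋)}` — SMALLNESS IN `α₀` ALONE, NO
weight window (`uniform_layer_fullG` at `γ = 1∕16`, §2, §1). [cite: Balaban1985BackgroundPropagators, (3.35)–(3.36) p.396, (3.63)–(3.65) pp.402–403 (shapes, mechanism); King1986, Lemma 4.5 (4.38) p.674 (shape)] -/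
theorem zOp_family_letters (hLodd : Odd L) (hL2 : 2 ≤ L) (hL : Odd L ∧ 1 < L) {b : ℝ} (hb : 0 < b) (c35 : ℝ) (hc35 : 0 < c35) :
    ∃ δZ ζ τ a₁ : ℝ, 0 < δZ ∧ 0 < ζ ∧ 0 < τ ∧ 0 < a₁ ∧
      ∀ (i : TGIndex × Fin (d + 1)) (α₀ : ℝ), 0 < α₀ → α₀ ≤ a₁ →
        ∀ U : (fgInstanceC2 d hL i).Bf.Cfg, (fgInstanceC2 d hL i).Bf.Reg335 c35 α₀ U →
          (∀ p q : B4.Idx (pbox (TGIndex.Mn d hL i.1)) (d + 1),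
              |unitBondMat (TGIndex.Mn d hL i.1) (zOp d (TGIndex.Mn d hL i.1) (L ^ i.1.k) b (avg₁ (Fin (d + 1)) (kingPrV L i.1.k i.1.m (TGIndex.Mn d hL i.1)) U).1
                  (avg₁ (Fin (d + 1)) (kingPrV L i.1.k i.1.m (TGIndex.Mn d hL i.1)) U).2) p q|
                ≤ ζ * α₀ * Real.exp (-(δZ * pdist (TGIndex.Mn d hL i.1) (one_le_M _) (p.1 : Fin (d + 1) → ℤ) (q.1 : Fin (d + 1) → ℤ)))) ∧
          (∀ p q : B4.Idx (pbox (TGIndex.Mn d hL i.1)) (d + 1),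
              |unitBondMat (TGIndex.Mn d hL i.1) (zOp d (TGIndex.Mn d hL i.1) (L ^ i.1.m * L ^ i.1.k) b U.1 U.2) p q|
                ≤ ζ * α₀ * Real.exp (-(δZ * pdist (TGIndex.Mn d hL i.1) (one_le_M _) (p.1 : Fin (d + 1) → ℤ) (q.1 : Fin (d + 1) → ℤ)))) ∧
          (∀ p q : B4.Idx (pbox (TGIndex.Mn d hL i.1)) (d + 1),
              |unitBondMat (TGIndex.Mn d hL i.1) (zOp d (TGIndex.Mn d hL i.1) (L ^ i.1.m * L ^ i.1.k) b U.1 U.2) p q -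
                  unitBondMat (TGIndex.Mn d hL i.1) (zOp d (TGIndex.Mn d hL i.1) (L ^ i.1.k) b (avg₁ (Fin (d + 1)) (kingPrV L i.1.k i.1.m (TGIndex.Mn d hL i.1)) U).1
                    (avg₁ (Fin (d + 1)) (kingPrV L i.1.k i.1.m (TGIndex.Mn d hL i.1)) U).2) p q|
                ≤ τ * ((L : ℝ) ^ i.1.k) ^ (-(1 / 16 : ℝ)) *
                    Real.exp (-(δZ * pdist (TGIndex.Mn d hL i.1) (one_le_M _) (p.1 : Fin (d + 1) → ℤ) (q.1 : Fin (d + 1) → ℤ)))) := by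
  obtain ⟨δ, β, m₀, cT, mT, hδ, -, hβ, hm₀, -, -, -, H⟩ :=
    uniform_layer_fullG (d := d) hLodd hL2 hL hb (γ := (1 / 16 : ℝ)) (by norm_num) le_rfl c35 (δ₂ := 1) (B₂ := 0) one_pos le_rfl
  have hd0 : (0 : ℝ) ≤ d := Nat.cast_nonneg d
  have hcr := latticeConst_nonneg (d + 1) (by positivity : (0 : ℝ) ≤ δ / 4)
  -- the guard quantity and the threshold
  have hQ0 : 0 ≤ β * ((2 * (d : ℝ) + 3) * c35 * ((d : ℝ) + 2)) * latticeConst (d + 1) (δ / 4) := by positivity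
  refine ⟨δ / 4,
    2 * β ^ 2 * ((d : ℝ) + 2) * latticeConst (d + 1) (δ / 4) * ((2 * (d : ℝ) + 3) * c35) * Real.exp δ * latticeConst (d + 1) (δ / 4) * Real.exp δ + 1,
    (2 * β ^ 2 * ((d : ℝ) + 2) * latticeConst (d + 1) (δ / 4) * ((2 * (d : ℝ) + 3) * c35)) * 2 * Real.exp δ * latticeConst (d + 1) (δ / 4) * Real.exp δ
      + (bgConst β (latticeConst (d + 1) (δ / 4)) m₀ ((2 * (d : ℝ) + 3) * c35 * (1 + Fintype.card (Fin (d + 1))))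
          (min 1 (1 / (2 * (β * ((2 * (d : ℝ) + 3) * c35 * ((d : ℝ) + 2)) * latticeConst (d + 1) (δ / 4) + 1)))) + m₀) * Real.exp δ * latticeConst (d + 1) (δ / 4) * Real.exp δ
      + β * (2 * β * ((2 * (d : ℝ) + 3) * c35) * ((d : ℝ) + 2)) * Real.exp δ * latticeConst (d + 1) (δ / 4) * latticeConst (d + 1) (δ / 4) * Real.exp δ + 1,
    min 1 (1 / (2 * (β * ((2 * (d : ℝ) + 3) * c35 * ((d : ℝ) + 2)) * latticeConst (d + 1) (δ / 4) + 1))),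
    by positivity, by positivity, ?_, lt_min one_pos (by positivity), fun i α₀ hα₀ hα₁ U hU => ?_⟩
  · have hmin0 : 0 ≤ min 1 (1 / (2 * (β * ((2 * (d : ℝ) + 3) * c35 * ((d : ℝ) + 2)) * latticeConst (d + 1) (δ / 4) + 1))) :=
      le_min zero_le_one (by positivity)
    have := bgConst_nonneg hβ.le hcr hm₀.le (by positivity : (0 : ℝ) ≤ (2 * (d : ℝ) + 3) * c35 * (1 + Fintype.card (Fin (d + 1)))) hmin0
    positivity
  have ha₁1 : min 1 (1 / (2 * (β * ((2 * (d : ℝ) + 3) * c35 * ((d : ℝ) + 2)) * latticeConst (d + 1) (δ / 4) + 1))) ≤ 1 := min_le_left _ _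
  have hq : β * ((2 * (d : ℝ) + 3) * c35 * ((d : ℝ) + 2)) * latticeConst (d + 1) (δ / 4) *
      min 1 (1 / (2 * (β * ((2 * (d : ℝ) + 3) * c35 * ((d : ℝ) + 2)) * latticeConst (d + 1) (δ / 4) + 1))) ≤ 1 / 2 := by
    have h1 : β * ((2 * (d : ℝ) + 3) * c35 * ((d : ℝ) + 2)) * latticeConst (d + 1) (δ / 4) *
        min 1 (1 / (2 * (β * ((2 * (d : ℝ) + 3) * c35 * ((d : ℝ) + 2)) * latticeConst (d + 1) (δ / 4) + 1)))
        ≤ β * ((2 * (d : ℝ) + 3) * c35 * ((d : ℝ) + 2)) * latticeConst (d + 1) (δ / 4) *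
          (1 / (2 * (β * ((2 * (d : ℝ) + 3) * c35 * ((d : ℝ) + 2)) * latticeConst (d + 1) (δ / 4) + 1))) :=
      mul_le_mul_of_nonneg_left (min_le_right _ _) hQ0
    refine h1.trans ?_
    rw [mul_one_div, div_le_iff₀ (by positivity)]
    nlinarith
  obtain ⟨hG, hD, hG', hD', -, hDG, hDD, -⟩ := H i
  obtain ⟨h1, h2, h3⟩ := hasMaj_zOp_letters_at (L := L) hL hc35 i hδ hβ.le hm₀.le hα₀ hα₁ ha₁1 hq hG hD hG' hD' hDG hDD hU
  have hζ : (2 * β ^ 2 * ((d : ℝ) + 2) * latticeConst (d + 1) (δ / 4) * ((2 * (d : ℝ) + 3) * c35) * Real.exp δ * latticeConst (d + 1) (δ / 4) * Real.exp δ) * α₀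
      ≤ (2 * β ^ 2 * ((d : ℝ) + 2) * latticeConst (d + 1) (δ / 4) * ((2 * (d : ℝ) + 3) * c35) * Real.exp δ * latticeConst (d + 1) (δ / 4) * Real.exp δ + 1) * α₀ :=
    mul_le_mul_of_nonneg_right (by linarith) hα₀.le
  have hζ0 : 0 ≤ (2 * β ^ 2 * ((d : ℝ) + 2) * latticeConst (d + 1) (δ / 4) * ((2 * (d : ℝ) + 3) * c35) * Real.exp δ * latticeConst (d + 1) (δ / 4) * Real.exp δ) * α₀ := by
    positivity
  have hrate : ∀ p q : B4.Idx (pbox (TGIndex.Mn d hL i.1)) (d + 1),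
      (2 * β ^ 2 * ((d : ℝ) + 2) * latticeConst (d + 1) (δ / 4) * ((2 * (d : ℝ) + 3) * c35) * Real.exp δ * latticeConst (d + 1) (δ / 4) * Real.exp δ) * α₀ *
          Real.exp (-(δ / 2 * pdist (TGIndex.Mn d hL i.1) (one_le_M _) (p.1 : Fin (d + 1) → ℤ) (q.1 : Fin (d + 1) → ℤ)))
        ≤ (2 * β ^ 2 * ((d : ℝ) + 2) * latticeConst (d + 1) (δ / 4) * ((2 * (d : ℝ) + 3) * c35) * Real.exp δ * latticeConst (d + 1) (δ / 4) * Real.exp δ + 1) * α₀ *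
          Real.exp (-(δ / 4 * pdist (TGIndex.Mn d hL i.1) (one_le_M _) (p.1 : Fin (d + 1) → ℤ) (q.1 : Fin (d + 1) → ℤ))) := fun p q =>
    (exp_decay_mono hζ0 (by linarith : δ / 4 ≤ δ / 2) (T4Cov2156Rate.bondDist_nonneg (one_le_M _) p q)).trans (mul_le_mul_of_nonneg_right hζ (Real.exp_nonneg _))
  refine ⟨fun p q => ?_, fun p q => ?_, fun p q => ?_⟩
  · exact (abs_unitBondMat_le_of_hasMaj (TGIndex.Mn d hL i.1) i.1.k hζ0 h1 p q).trans (hrate p q)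
  · exact (abs_unitBondMat_le_of_hasMaj (TGIndex.Mn d hL i.1) i.1.k hζ0 h2 p q).trans (hrate p q)
  · rw [← Matrix.sub_apply, ← unitBondMat_sub]
    have hθ0 : 0 ≤ ((L : ℝ) ^ i.1.k) ^ (-(1 / 16 : ℝ)) := Real.rpow_nonneg (pow_nonneg (Nat.cast_nonneg _) _) _
    have hmin0 : 0 ≤ min 1 (1 / (2 * (β * ((2 * (d : ℝ) + 3) * c35 * ((d : ℝ) + 2)) * latticeConst (d + 1) (δ / 4) + 1))) :=
      le_min zero_le_one (by positivity)
    have hB := bgConst_nonneg hβ.le hcr hm₀.le (by positivity : (0 : ℝ) ≤ (2 * (d : ℝ) + 3) * c35 * (1 + Fintype.card (Fin (d + 1)))) hmin0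
    refine (abs_unitBondMat_le_of_hasMaj (TGIndex.Mn d hL i.1) i.1.k ?_ h3 p q).trans (mul_le_mul_of_nonneg_right (mul_le_mul_of_nonneg_right (by linarith) hθ0) (Real.exp_nonneg _))
    positivity

end Family



end Summit.QuantumFields.YangMills.BalabanUVNodes.N15.UnitLayerBg

end
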